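import Mathlib.Analysis.Distribution.SchwartzSpace.Deriv
import Mathlib.Analysis.Calculus.FDeriv.Symmetric
import Mathlib.Analysis.Calculus.MeanValue
import Mathlib.Topology.UniformSpace.HeineCantor
import Literature.MathematicalPhysics.QuantumLattice.EuclideanAction
import HarnessLib

/-!
# Difference quotients of translates converge to the directional derivative in the Schwartz topology
# (crux stmt-QuantumFields-16192, line `WardDefectSketch`, sub-goal (W-exact a))

Support file for the crux item stmt-QuantumFields-16192 (`CoincidenceRotationBootstrap.CurvatureAmnesia`, shared
verbatim with `ScalingWindowSplit.CurvatureAmnesia`).  Step (W-exact a) of the lattice rotation-Ward engine of line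
`WardDefectSketch` replaces the continuum derivatives `∂_μ f` of a test function, sampled on the lattice `a_k ℤ⁴`, by
LATTICE difference quotients `(f(· + a_k e_μ) − f)/a_k` (so that summation by parts on `ℤ⁴` applies); since the
lattice correlators are an equicontinuous family of continuous multilinear forms on `𝓢(ℝ⁴, ℝ)`, the error must
tend to zero in the SCHWARTZ topology.  This file proves that analysis fact, the registered sub-goal
`tendsto_diffQuotient_schwartz`:

  for `f ∈ 𝓢(ℝ⁴, ℝ)` of compact support and `v ∈ ℝ⁴`,
  `t⁻¹ • (f(· + t v) − f) ⟶ ∂_v f` in `𝓢(ℝ⁴, ℝ)` as `t → 0`, `t ≠ 0`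

(`translateTest (-(t • v)) f = f (· + t v)`, `∂_{v} f = LineDeriv.lineDerivOp v f`, `(∂_{v} f)(x) = Df(x) v`).

## Proof

The topology of `𝓢(E, ℝ)` is given by the seminorms `p_{k,n}(g) = sup_x ‖x‖^k ‖Dⁿg(x)‖`
(`schwartz_withSeminorms`, `WithSeminorms.tendsto_nhds`), so it suffices to make every `p_{k,n}` of
`g_t = t⁻¹ (f(· + t v) − f) − ∂_v f` small.  With `Φ = Dⁿf` (a `C¹`, compactly supported, vector-valued map),

* `Dⁿ g_t (x) = t⁻¹ (Φ(x + t v) − Φ(x)) − DΦ(x) v` (`DiffQuotient.iteratedFDeriv_diffQuot`), using that `Dⁿ`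
  commutes with translations and `Dⁿ(∂_v f)(x) = (D Dⁿf)(x) v` (`DiffQuotient.iteratedFDeriv_fderiv_apply`: the
  innermost and the outermost slot of `Dⁿ⁺¹f(x)` may be exchanged — induction on `n` over all target spaces at
  once, the step being the symmetry of SECOND derivatives `ContDiffAt.isSymmSndFDerivAt`; Mathlib has the
  all-orders symmetry of `iteratedFDeriv` only for analytic maps);
* the mean value inequality on the segment `s ↦ x + s v` for `s ↦ Φ(x + s v) − s DΦ(x) v` and the UNIFORM
  continuity of the compactly supported continuous `DΦ` give `‖Dⁿ g_t (x)‖ ≤ ε` for `0 < |t| < δ`, uniformly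
  in `x` (`DiffQuotient.exists_forall_norm_diffQuot_sub_fderiv_le`);
* if `tsupport f ⊆ closedBall 0 R` then `Dⁿ g_t (x) = 0` for `‖x‖ > R + ‖v‖`, `|t| ≤ 1`, so the weight `‖x‖^k`
  costs at most the constant `(R + ‖v‖)^k` (`DiffQuotient.tendsto_diffQuot`, any real normed space `E : Type`).

Everything is proved, from Mathlib (`SchwartzMap.seminorm_le_bound`, `iteratedFDeriv_comp_sub`,
`iteratedFDeriv_succ_eq_comp_right`, `Convex.norm_image_sub_le_of_norm_hasDerivWithin_le`,
`HasCompactSupport.uniformContinuous_of_continuous`) and the tree's `translateTest` (= `SchwartzMap.compSubConstCLM`).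
The convergence holds for every Schwartz function; only the registered compact-support version is proved here.
No definitions, no notation.  References: L. Hörmander, *The Analysis of Linear Partial Differential Operators I*,
Thm. 2.1.3 and the remark preceding it (difference quotients of a `C_c^∞` function converge in `C_c^∞`); folklore.
-/

noncomputable section

namespace Summit.QuantumFields.YangMills.Cruxes.CurvatureAmnesia.WardDefect

open scoped BigOperators Topology SchwartzMap LineDeriv ContDiff
open Filter
open Literature.MathematicalPhysics.QuantumLattice

universe u

namespace DiffQuotient

variable {E : Type u} [NormedAddCommGroup E] [NormedSpace ℝ E]

/-- **Innermost slot = outermost slot.**  For a smooth vector-valued map `G`, the `n`-th derivative of the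
directional derivative `y ↦ DG(y) v` is the directional derivative of the `n`-th derivative:
`Dⁿ(y ↦ DG(y) v)(x) = (D DⁿG)(x) v`, i.e. `Dⁿ⁺¹G(x)(m₁, …, mₙ, v) = Dⁿ⁺¹G(x)(v, m₁, …, mₙ)`.  Induction on `n`,
simultaneously for all target spaces: `Dⁿ⁺¹h = R⁻¹ ∘ Dⁿ(Dh)` (`iteratedFDeriv_succ_eq_comp_right`) and
`D(y ↦ DG(y) v) = (y ↦ D(DG)(y) v)` by the symmetry of the second derivative (`ContDiffAt.isSymmSndFDerivAt`).
[folklore] -/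
theorem iteratedFDeriv_fderiv_apply (n : ℕ) :
    ∀ {F : Type u} [NormedAddCommGroup F] [NormedSpace ℝ F] {G : E → F}, ContDiff ℝ ∞ G →
      ∀ (v x : E), iteratedFDeriv ℝ n (fun y => fderiv ℝ G y v) x = fderiv ℝ (iteratedFDeriv ℝ n G) x v := by
  induction n with
  | zero =>
      intro F _ _ G _ v x
      ext m
      rw [iteratedFDeriv_zero_apply, iteratedFDeriv_zero_eq_comp, LinearIsometryEquiv.comp_fderiv,
        ContinuousLinearMap.comp_apply]
      simp
  | succ n ih =>
      intro F _ _ G hG v x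
      have hG' : ContDiff ℝ ∞ (fderiv ℝ G) := hG.fderiv_right (m := ∞) (by simp)
      -- symmetry of the second derivative: `D(y ↦ DG(y) v)(y) = D(DG)(y) v`
      have hsym : (fun y => fderiv ℝ (fun z => fderiv ℝ G z v) y) = fun y => fderiv ℝ (fderiv ℝ G) y v := by
        funext y
        ext w
        rw [fderiv_clm_apply (hG'.differentiable (by simp) y) (differentiableAt_const v)]
        simp only [fderiv_fun_const, Pi.zero_apply, ContinuousLinearMap.comp_zero, zero_add,
          ContinuousLinearMap.flip_apply]
        exact (hG.contDiffAt.isSymmSndFDerivAt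
          (by simp only [minSmoothness_of_isRCLikeNormedField]; decide)).eq w v
      have hfun : iteratedFDeriv ℝ (n + 1) G =
          (continuousMultilinearCurryRightEquiv' ℝ n E F).symm ∘ iteratedFDeriv ℝ n (fderiv ℝ G) := by
        funext y
        exact iteratedFDeriv_succ_eq_comp_right
      calc iteratedFDeriv ℝ (n + 1) (fun y => fderiv ℝ G y v) x
          = ((continuousMultilinearCurryRightEquiv' ℝ n E F).symm ∘
              iteratedFDeriv ℝ n (fun y => fderiv ℝ (fun z => fderiv ℝ G z v) y)) x :=
            iteratedFDeriv_succ_eq_comp_right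
        _ = (continuousMultilinearCurryRightEquiv' ℝ n E F).symm
              (fderiv ℝ (iteratedFDeriv ℝ n (fderiv ℝ G)) x v) := by
            rw [Function.comp_apply, hsym, ih hG' v x]
        _ = fderiv ℝ (iteratedFDeriv ℝ (n + 1) G) x v := by
            rw [hfun]
            exact (DFunLike.congr_fun ((continuousMultilinearCurryRightEquiv' ℝ n E F).symm.comp_fderiv
              (f := iteratedFDeriv ℝ n (fderiv ℝ G)) (x := x)) v).symm

/-- **Uniform convergence of the difference quotients of a `C¹` compactly supported vector-valued map.**
If `D : E → F` is `C¹` with compact support, then for every `ε > 0` there is `δ > 0` with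
`‖t⁻¹ (D(x + t v) − D(x)) − (fderiv ℝ D x) v‖ ≤ ε` for all `0 < |t| < δ` and ALL `x`: the mean value inequality
for `s ↦ D(x + s v) − s (fderiv ℝ D x) v` on the segment `[0, t]` and the uniform continuity of the compactly
supported continuous derivative `fderiv ℝ D` (Heine–Cantor). [folklore] -/
theorem exists_forall_norm_diffQuot_sub_fderiv_le {F : Type*} [NormedAddCommGroup F] [NormedSpace ℝ F]
    {D : E → F} (hD : ContDiff ℝ 1 D) (hsupp : HasCompactSupport D) (v : E) {ε : ℝ} (hε : 0 < ε) :
    ∃ δ > (0 : ℝ), ∀ t : ℝ, t ≠ 0 → |t| < δ → ∀ x : E,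
      ‖t⁻¹ • (D (x + t • v) - D x) - fderiv ℝ D x v‖ ≤ ε := by
  have hdiff : Differentiable ℝ D := hD.differentiable one_ne_zero
  have huc : UniformContinuous (fderiv ℝ D) :=
    (hsupp.fderiv (𝕜 := ℝ)).uniformContinuous_of_continuous (hD.continuous_fderiv one_ne_zero)
  obtain ⟨η, hη, hηε⟩ := Metric.uniformContinuous_iff.1 huc (ε / (‖v‖ + 1)) (by positivity)
  refine ⟨η / (‖v‖ + 1), by positivity, fun t ht htδ x => ?_⟩
  -- the derivative `fderiv ℝ D` varies by at most `ε / (‖v‖ + 1)` along the segment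
  have hclose : ∀ s : ℝ, |s| ≤ |t| → ‖fderiv ℝ D (x + s • v) - fderiv ℝ D x‖ ≤ ε / (‖v‖ + 1) := by
    intro s hs
    rw [← dist_eq_norm]
    refine (hηε ?_).le
    rw [dist_eq_norm, add_sub_cancel_left, norm_smul, Real.norm_eq_abs]
    calc |s| * ‖v‖ ≤ |t| * ‖v‖ := by gcongr
      _ ≤ η / (‖v‖ + 1) * ‖v‖ := by gcongr
      _ < η := by
          rw [div_mul_eq_mul_div, div_lt_iff₀ (by positivity)]
          nlinarith [norm_nonneg v]
  -- the path `φ s = D(x + s v) − s (fderiv ℝ D x) v`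
  set φ : ℝ → F := fun s => D (x + s • v) - s • fderiv ℝ D x v with hφ
  have hφd : ∀ s, HasDerivAt φ (fderiv ℝ D (x + s • v) v - fderiv ℝ D x v) s := by
    intro s
    have hγ : HasDerivAt (fun s : ℝ => x + s • v) v s := by
      simpa using ((hasDerivAt_id s).smul_const v).const_add x
    have h1 : HasDerivAt (fun s : ℝ => D (x + s • v)) (fderiv ℝ D (x + s • v) v) s :=
      (hdiff (x + s • v)).hasFDerivAt.comp_hasDerivAt s hγ
    have h2 : HasDerivAt (fun s : ℝ => s • fderiv ℝ D x v) (fderiv ℝ D x v) s := by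
      simpa using (hasDerivAt_id s).smul_const (fderiv ℝ D x v)
    exact h1.sub h2
  -- mean value inequality on the segment between `0` and `t`
  have hmv : ‖φ t - φ 0‖ ≤ ε / (‖v‖ + 1) * ‖v‖ * |t| := by
    have h := (convex_uIcc (0 : ℝ) t).norm_image_sub_le_of_norm_hasDerivWithin_le
      (f := φ) (C := ε / (‖v‖ + 1) * ‖v‖) (fun s _ => (hφd s).hasDerivWithinAt) (fun s hs => ?_)
      Set.left_mem_uIcc Set.right_mem_uIcc
    · simpa only [sub_zero, Real.norm_eq_abs] using h
    · have hs' : |s| ≤ |t| := by simpa only [sub_zero] using Set.abs_sub_left_of_mem_uIcc hs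
      calc ‖fderiv ℝ D (x + s • v) v - fderiv ℝ D x v‖
          = ‖(fderiv ℝ D (x + s • v) - fderiv ℝ D x) v‖ := by rw [sub_apply]
        _ ≤ ‖fderiv ℝ D (x + s • v) - fderiv ℝ D x‖ * ‖v‖ := ContinuousLinearMap.le_opNorm _ _
        _ ≤ ε / (‖v‖ + 1) * ‖v‖ := by gcongr; exact hclose s hs'
  -- divide by `t`
  have hkey : φ t - φ 0 = t • (t⁻¹ • (D (x + t • v) - D x) - fderiv ℝ D x v) := by
    simp only [hφ, zero_smul, add_zero, sub_zero, smul_sub, smul_smul, mul_inv_cancel₀ ht, one_smul]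
    abel
  rw [hkey, norm_smul, Real.norm_eq_abs] at hmv
  have ht0 : 0 < |t| := abs_pos.2 ht
  have hle : ‖t⁻¹ • (D (x + t • v) - D x) - fderiv ℝ D x v‖ ≤ ε / (‖v‖ + 1) * ‖v‖ :=
    le_of_mul_le_mul_left (by linarith [hmv]) ht0
  calc ‖t⁻¹ • (D (x + t • v) - D x) - fderiv ℝ D x v‖ ≤ ε / (‖v‖ + 1) * ‖v‖ := hle
    _ ≤ ε := by
        rw [div_mul_eq_mul_div, div_le_iff₀ (by positivity)]
        nlinarith [norm_nonneg v]

end DiffQuotient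

namespace DiffQuotient

/-! The Schwartz-space statements: here the space `E` lives in `Type` (as `ℝ` does), so that
`iteratedFDeriv_fderiv_apply` (one universe for the domain and all the target spaces `ℝ`, `E →L[ℝ] ℝ`, …)
applies. -/

variable {E : Type} [NormedAddCommGroup E] [NormedSpace ℝ E]

/-- **The `n`-th derivative of the error term.**  For a real Schwartz function `f`, a direction `v` and `t ∈ ℝ`,
the `n`-th Fréchet derivative of `g_t = t⁻¹ (f(· + t v) − f) − ∂_v f` at `x` is
`t⁻¹ (Dⁿf(x + t v) − Dⁿf(x)) − (D Dⁿf)(x) v` (`Dⁿ` is linear, commutes with translations, and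
`Dⁿ(∂_v f) = (D Dⁿf)(·) v` by `iteratedFDeriv_fderiv_apply`). [folklore] -/
theorem iteratedFDeriv_diffQuot (f : 𝓢(E, ℝ)) (v : E) (t : ℝ) (n : ℕ) (x : E) :
    iteratedFDeriv ℝ n (⇑(t⁻¹ • (translateTest (-(t • v)) f - f) - ∂_{v} f)) x =
      t⁻¹ • (iteratedFDeriv ℝ n f (x + t • v) - iteratedFDeriv ℝ n f x) -
        fderiv ℝ (iteratedFDeriv ℝ n f) x v := by
  have hn : ∀ g : 𝓢(E, ℝ), ContDiff ℝ n (⇑g) := fun g => g.smooth n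
  have h1 : ContDiff ℝ n (⇑(translateTest (-(t • v)) f) - ⇑f) := (hn _).sub (hn _)
  have h2 : ContDiff ℝ n (t⁻¹ • (⇑(translateTest (-(t • v)) f) - ⇑f)) := h1.const_smul t⁻¹
  have hcoe : (⇑(t⁻¹ • (translateTest (-(t • v)) f - f) - ∂_{v} f) : E → ℝ) =
      t⁻¹ • (⇑(translateTest (-(t • v)) f) - ⇑f) - ⇑(∂_{v} f : 𝓢(E, ℝ)) := rfl
  rw [hcoe, iteratedFDeriv_sub_apply h2.contDiffAt (hn _).contDiffAt,
    iteratedFDeriv_const_smul_apply h1.contDiffAt,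
    iteratedFDeriv_sub_apply (hn _).contDiffAt (hn _).contDiffAt]
  have htr : iteratedFDeriv ℝ n (⇑(translateTest (-(t • v)) f)) x = iteratedFDeriv ℝ n f (x + t • v) := by
    have h : (⇑(translateTest (-(t • v)) f) : E → ℝ) = fun z => f (z - -(t • v)) := rfl
    rw [h, iteratedFDeriv_comp_sub, sub_neg_eq_add]
  have hld : iteratedFDeriv ℝ n (⇑(∂_{v} f : 𝓢(E, ℝ))) x = fderiv ℝ (iteratedFDeriv ℝ n f) x v := by
    have h : (⇑(∂_{v} f : 𝓢(E, ℝ)) : E → ℝ) = fun y => fderiv ℝ f y v := rfl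
    rw [h]
    exact iteratedFDeriv_fderiv_apply n (f.smooth ⊤) v x
  rw [htr, hld]

/-- **Difference quotients of translates converge in `𝓢` (compact support, any real normed space).**  For a
compactly supported real Schwartz function `f` on `E` and `v ∈ E`,
`t⁻¹ • (f(· + t v) − f) → ∂_v f` in the Schwartz topology as `t → 0`, `t ≠ 0`: every seminorm
`sup_x ‖x‖^k ‖Dⁿ(t⁻¹(f(·+tv) − f) − ∂_v f)(x)‖` tends to `0` by `iteratedFDeriv_diffQuot`,
`exists_forall_norm_diffQuot_sub_fderiv_le` for `D = Dⁿf`, and the uniform bound `R + ‖v‖` on the supports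
(Hörmander, *ALPDO I*, Thm. 2.1.3 and the preceding remark). [folklore] -/
theorem tendsto_diffQuot (f : 𝓢(E, ℝ)) (hf : HasCompactSupport (f : E → ℝ)) (v : E) :
    Tendsto (fun t : ℝ => t⁻¹ • (translateTest (-(t • v)) f - f)) (𝓝[≠] 0) (𝓝 (∂_{v} f)) := by
  rw [(schwartz_withSeminorms ℝ E ℝ).tendsto_nhds]
  rintro ⟨k, n⟩ ε hε
  -- a ball containing the support of `f`; the derivatives of `f` vanish off it
  obtain ⟨R, hR0, hR⟩ := hf.isCompact.isBounded.subset_closedBall_lt 0 (0 : E)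
  have hDzero : ∀ y : E, R < ‖y‖ → iteratedFDeriv ℝ n f y = 0 := fun y hy =>
    Function.notMem_support.1 fun h => by
      have h' := hR (support_iteratedFDeriv_subset n h)
      rw [Metric.mem_closedBall, dist_zero_right] at h'
      exact (not_le.2 hy) h'
  have hfDzero : ∀ y : E, R < ‖y‖ → fderiv ℝ (iteratedFDeriv ℝ n f) y = 0 := fun y hy =>
    Function.notMem_support.1 fun h => by
      have h' := hR (tsupport_iteratedFDeriv_subset n (support_fderiv_subset ℝ h))
      rw [Metric.mem_closedBall, dist_zero_right] at h'
      exact (not_le.2 hy) h'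
  -- regularity of `D = Dⁿ f` and the uniform estimate
  have hD1 : ContDiff ℝ 1 (iteratedFDeriv ℝ n f) :=
    (f.smooth ⊤).iteratedFDeriv_right (by exact_mod_cast le_top)
  have hDsupp : HasCompactSupport (iteratedFDeriv ℝ n f) := hf.iteratedFDeriv n
  have hC : 0 < (R + ‖v‖) ^ k := by positivity
  obtain ⟨δ, hδ, hest⟩ :=
    exists_forall_norm_diffQuot_sub_fderiv_le hD1 hDsupp v (div_pos (half_pos hε) hC)
  rw [eventually_nhdsWithin_iff, Metric.eventually_nhds_iff]
  refine ⟨min δ 1, lt_min hδ one_pos, fun {t} ht ht0 => ?_⟩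
  have ht0' : t ≠ 0 := fun h => ht0 (Set.mem_singleton_iff.2 h)
  rw [dist_zero_right, Real.norm_eq_abs, lt_min_iff] at ht
  refine lt_of_le_of_lt (SchwartzMap.seminorm_le_bound ℝ k n _ (half_pos hε).le fun x => ?_)
    (half_lt_self hε)
  rw [iteratedFDeriv_diffQuot f v t n x]
  by_cases hx : ‖x‖ ≤ R + ‖v‖
  · calc ‖x‖ ^ k * ‖t⁻¹ • (iteratedFDeriv ℝ n f (x + t • v) - iteratedFDeriv ℝ n f x) -
          fderiv ℝ (iteratedFDeriv ℝ n f) x v‖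
        ≤ (R + ‖v‖) ^ k * (ε / 2 / (R + ‖v‖) ^ k) :=
          mul_le_mul (pow_le_pow_left₀ (norm_nonneg _) hx k) (hest t ht0' ht.1 x) (norm_nonneg _)
            hC.le
      _ = ε / 2 := mul_div_cancel₀ _ hC.ne'
  · have hx' : R + ‖v‖ < ‖x‖ := not_le.1 hx
    have hv0 : 0 ≤ ‖v‖ := norm_nonneg v
    have h1 : iteratedFDeriv ℝ n f x = 0 := hDzero x (by linarith)
    have h2 : fderiv ℝ (iteratedFDeriv ℝ n f) x = 0 := hfDzero x (by linarith)
    have h3 : iteratedFDeriv ℝ n f (x + t • v) = 0 := by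
      refine hDzero _ ?_
      have hle : ‖x‖ ≤ ‖x + t • v‖ + ‖t • v‖ := norm_le_add_norm_add x (t • v)
      have htv : ‖t • v‖ ≤ ‖v‖ := by
        rw [norm_smul, Real.norm_eq_abs]
        exact (mul_le_mul_of_nonneg_right ht.2.le hv0).trans (one_mul ‖v‖).le
      linarith
    rw [h1, h2, h3]
    simpa using (half_pos hε).le

end DiffQuotient

/-- **(W-exact a) Schwartz-topology convergence of translation difference quotients of compactly supported test
functions.**  For a compactly supported `f ∈ 𝓢(ℝ⁴, ℝ)` and `v ∈ ℝ⁴`, the difference quotients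
`t⁻¹ • (f(· + t v) − f) = t⁻¹ • (translateTest (-(t • v)) f − f)` converge to the directional derivative
`∂_v f = LineDeriv.lineDerivOp v f` in `𝓢(ℝ⁴, ℝ)` as `t → 0`, `t ≠ 0` (registered sub-goal of crux
stmt-QuantumFields-16192, line `WardDefectSketch`; `DiffQuotient.tendsto_diffQuot` at `E = ℝ⁴`). [folklore] -/
theorem tendsto_diffQuotient_schwartz : ∀ (f : 𝓢(EuclideanSpace ℝ (Fin 4), ℝ)), HasCompactSupport (f : EuclideanSpace ℝ (Fin 4) → ℝ) → ∀ v : EuclideanSpace ℝ (Fin 4), Tendsto (fun t : ℝ => t⁻¹ • (translateTest (-(t • v)) f - f)) (𝓝[≠] 0) (𝓝 (LineDeriv.lineDerivOp v f)) :=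
  fun f hf v => DiffQuotient.tendsto_diffQuot f hf v

end Summit.QuantumFields.YangMills.Cruxes.CurvatureAmnesia.WardDefect

end
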